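import Literature.MathematicalPhysics.QuantumFieldTheory.U1WeakCouplingD4SingleBeta
import Literature.MathematicalPhysics.QuantumFieldTheory.U1DualFluxEnsemble
import Literature.MathematicalPhysics.QuantumFieldTheory.WilsonLoopReversal
import HarnessLib

/-!
# The Wilson-action perimeter law from a bound on the dual (flux) partition functions

Support file of the proof programme of the named fact
`Literature.MathematicalPhysics.QuantumFieldTheory.FrohlichSpencerU1PerimeterLawD4`
(Fröhlich–Spencer 1982 p. 433 / Guth 1980: perimeter law of `U(1)₄` with Wilson's action). The
tree already reduces the fact to a finite-volume statement at ONE inverse coupling `β₀`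
(`U1WeakCouplingD4SingleBeta.frohlichSpencerU1PerimeterLawD4_of_single_beta`: Griffiths
monotonicity in `β` and in the volume), represents the free-boundary Wilson-loop expectation as a
ratio of dual (flux) partition functions `⟨W_γ⟩_{Λ,β} = Z_Λ(J_γ)/Z_Λ(0)`
(`U1DualRepresentation.zdExpect_u1_wilsonLoop_eq_dual`, FS82 §2.3 (2.19)–(2.24) for the Wilson
weights `I_n(β)`), and rewrites `Z_Λ(J_γ)` as the closed-flux ensemble with the sheet `S_γ`
inserted (`U1DualFluxEnsemble`, for coordinate planes `i < j`). This file records the resulting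
**exact target of the dual analysis** (FS82 §§2.5–2.10 run with the Bessel weights, p. 433):

* `frohlichSpencerU1PerimeterLawD4_of_dual_ratio` — it suffices to find `β₀ ≥ 0` and `c > 0` such that
  for every rectangular loop `γ` in a coordinate plane `i < j` (both sides `≥ 1`) and for
  arbitrarily large centred boxes `Λ = box 4 n`,
  `e^{-c·|γ|} Z_Λ(0) ≤ Z_Λ(J_γ)`, `|γ| = 2(R + T)`;
  the planes `i > j` are reduced to `i < j` by loop reversal (`WilsonLoopReversal`);
* `frohlichSpencerU1PerimeterLawD4_of_closedFlux_ratio` — the same with both partition functions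
  written as closed-flux ensembles, `e^{-c|γ|} ∑_{∂c=0} ∏ₚ I_{cₚ}(β₀) ≤ ∑_{∂c=0} ∏ₚ I_{cₚ + Sₚ}(β₀)`,
  for boxes containing the sheet of `γ` (which all large boxes do, `eventually_rectPlaqs_subset`).

Everything is proved; no named fact is introduced.

## References

* J. Fröhlich, T. Spencer, Comm. Math. Phys. 83 (1982) 411–454, §2.3 (2.19)–(2.24), (2.88), p. 433.
  [FrohlichSpencerCMP1982]
* A. H. Guth, Phys. Rev. D 21 (1980) 2291–2307. [Guth1980]
-/

noncomputable section

open MeasureTheory Filter Finset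
open scoped Topology
open Literature.Probability.LatticeModels Literature.MathematicalPhysics.QuantumLattice

namespace Literature.MathematicalPhysics.QuantumFieldTheory

open AreaLaw

/-- **The perimeter law from a lower bound on the dual partition functions at one `β₀`.**
If for some `β₀ ≥ 0`, `c > 0`, every loop in a plane `i < j` satisfies
`e^{-c|γ|} Z_{Λₙ}(0) ≤ Z_{Λₙ}(J_γ)` for arbitrarily large centred boxes `Λₙ`, then
`FrohlichSpencerU1PerimeterLawD4` holds. [cite: FrohlichSpencerCMP1982, §2.3 (2.24) and (2.88), p. 433] -/
theorem frohlichSpencerU1PerimeterLawD4_of_dual_ratio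
    (h : ∃ β₀ : ℝ, 0 ≤ β₀ ∧ ∃ c : ℝ, 0 < c ∧
      ∀ (x : Literature.Probability.LatticeModels.Site 4) (i j : Fin 4) (R T : ℕ),
        i < j → 1 ≤ R → 1 ≤ T →
          ∃ᶠ n : ℕ in atTop, Real.exp (-c * (2 * (R + T))) * zdU1DualPartition β₀ (box 4 n) 0 ≤
            zdU1DualPartition β₀ (box 4 n) (loopCurrent x i j R T)) :
    FrohlichSpencerU1PerimeterLawD4 := by
  obtain ⟨β₀, hβ₀, c, hc, hb⟩ := h
  refine frohlichSpencerU1PerimeterLawD4_of_single_beta ⟨β₀, hβ₀, c, hc, fun x i j R T hij hR hT => ?_⟩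
  -- the planes `i < j`
  have key : ∀ (i j : Fin 4) (R T : ℕ), i < j → 1 ≤ R → 1 ≤ T →
      ∃ᶠ n : ℕ in atTop, Real.exp (-c * (2 * (R + T))) ≤
        zdExpect u1Rep β₀ (box 4 n) (zdWilsonLoop u1Rep x i j R T) := by
    intro i j R T hlt hR hT
    refine (hb x i j R T hlt hR hT).mono fun n hn => ?_
    rw [zdExpect_u1_wilsonLoop_eq_dual, le_div_iff₀ (zdU1DualPartition_zero_pos _ _)]
    exact hn
  rcases lt_or_gt_of_ne hij with hlt | hgt
  · exact key i j R T hlt hR hT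
  · -- the planes `i > j`: reverse the loop
    have h' := key j i T R hgt hT hR
    rw [← zdWilsonLoop_u1Rep_swap x i j R T]
    have hper : ((R : ℝ) + T) = (T : ℝ) + R := add_comm _ _
    rw [hper]
    exact h'

open Classical in
/-- **The same target in closed-flux form**: it suffices that for some `β₀ ≥ 0`, `c > 0`, every loop
in a plane `i < j` and arbitrarily large centred boxes containing its sheet,
`e^{-c|γ|} ∑_{∂c = 0} ∏ₚ I_{cₚ}(β₀) ≤ ∑_{∂c = 0} ∏ₚ I_{cₚ + Sₚ}(β₀)` (sums over the closed integer
plaquette fields of the box, `S` the sheet of `γ`). [cite: FrohlichSpencerCMP1982, §2.3 (2.24)–(2.31), p. 433] -/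
theorem frohlichSpencerU1PerimeterLawD4_of_closedFlux_ratio
    (h : ∃ β₀ : ℝ, 0 ≤ β₀ ∧ ∃ c : ℝ, 0 < c ∧
      ∀ (x : Literature.Probability.LatticeModels.Site 4) (i j : Fin 4) (R T : ℕ),
        i < j → 1 ≤ R → 1 ≤ T →
          ∃ᶠ n : ℕ in atTop, rectPlaqs x i j R T ⊆ plaquettesIn (box 4 n) ∧
            Real.exp (-c * (2 * (R + T))) *
                (∑' m : ↥(plaquettesIn (box 4 n)) → ℤ,
                  if ∑ p, m p • plaqCurrent (p : Plaq 4) = 0 then ∏ p, besselI (m p) β₀ else 0) ≤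
              ∑' m : ↥(plaquettesIn (box 4 n)) → ℤ,
                if ∑ p, m p • plaqCurrent (p : Plaq 4) = 0 then
                  ∏ p, besselI (m p + sheet (box 4 n) x i j R T p) β₀ else 0) :
    FrohlichSpencerU1PerimeterLawD4 := by
  obtain ⟨β₀, hβ₀, c, hc, hb⟩ := h
  refine frohlichSpencerU1PerimeterLawD4_of_dual_ratio ⟨β₀, hβ₀, c, hc, fun x i j R T hij hR hT => ?_⟩
  refine (hb x i j R T hij hR hT).mono fun n hn => ?_
  obtain ⟨hsub, hle⟩ := hn
  rw [zdU1DualPartition_loopCurrent_eq_tsum_closed β₀ hij.ne hsub]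
  exact hle

end Literature.MathematicalPhysics.QuantumFieldTheory
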